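import Summits.CriticalPhenomena.PercolationContinuityZ3.Theorems.Transplant.FKConnectivityAllQApexHubRest
import HarnessLib

/-!
# Connectivity correlation inequalities for `φ_{w,q}` — the hub inequality at `(x; t; z)`: preparation II — the two rest events
# read by the doubly-attached cylinder are insensitive to the pair `uv`

Support file (`--supports stmt-CriticalPhenomena-4575`), census seat `prim-bschramm-census` (gen 23) of the post-continuity programme;
builds on p205010 (kernel theorem, internal audit signed; external expert review pending).  No definitions, no named facts, no sorries;
standard axioms.  For the `(x; t; z)` reduction (`…ApexHubRestTwoAlg.lean`, wrapper to follow) the doubly-attached cylinder of the apex `x`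
reads the events "`t` is joined to `u` or to `v`" and "`z ↔ t` after merging `u, v`" of the rest; to pass from the tilted masses of the table
lemma to masses under the `uv`-contracted weights (`sum_tilt_eq_update_one`) these events must be insensitive to the pair `uv`.  This file:
`symmDiff_singleton_eq_of_mem/_of_not_mem`, `insens_of_insert` (a toggle-insensitivity criterion), and the two insensitivity lemmas
`wT_insens`, `cZT_insens`, and `pre_insens` (the apex-deleted preimage form of an insensitive event is insensitive). [folklore]
[cite: Grimmett2006, §1.4 eq. (1.20) (p. 15)]
-/

noncomputable section

namespace Summit.CriticalPhenomena.PercolationContinuityZ3.Theorems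

namespace FK

open MeasureTheory Set Literature.Probability.LatticeModels Literature.Probability.Percolation
open scoped Classical symmDiff

variable {V : Type*}

/-- `ω ∆ {e} = ω ∖ {e}` when `e ∈ ω`. [folklore] -/
theorem symmDiff_singleton_eq_of_mem {ω : BondConfig V} {e : Sym2 V} (he : e ∈ ω) : ω ∆ {e} = ω \ {e} := by
  ext f
  simp only [Set.mem_symmDiff, Set.mem_singleton_iff, Set.mem_sdiff]
  constructor
  · rintro (⟨hf, hne⟩ | ⟨rfl, hn⟩)
    · exact ⟨hf, hne⟩
    · exact absurd he hn
  · rintro ⟨hf, hne⟩; exact Or.inl ⟨hf, hne⟩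

/-- `ω ∆ {e} = insert e ω` when `e ∉ ω`. [folklore] -/
theorem symmDiff_singleton_eq_of_not_mem {ω : BondConfig V} {e : Sym2 V} (he : e ∉ ω) : ω ∆ {e} = insert e ω := by
  ext f
  simp only [Set.mem_symmDiff, Set.mem_singleton_iff, Set.mem_insert_iff]
  constructor
  · rintro (⟨hf, -⟩ | ⟨rfl, -⟩)
    · exact Or.inr hf
    · exact Or.inl rfl
  · rintro (rfl | hf)
    · exact Or.inr ⟨rfl, he⟩
    · exact Or.inl ⟨hf, fun h => he (h ▸ hf)⟩

/-- **Toggle-insensitivity criterion**: if adding the pair `e` to any configuration not containing it does not change membership in `F`,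
then `F` is insensitive to `e`. [folklore] -/
theorem insens_of_insert {F : Set (BondConfig V)} {e : Sym2 V} (h : ∀ ξ : BondConfig V, e ∉ ξ → (insert e ξ ∈ F ↔ ξ ∈ F))
    (ω : BondConfig V) : ω ∆ {e} ∈ F ↔ ω ∈ F := by
  by_cases he : e ∈ ω
  · have hω : ω = insert e (ω \ {e}) := by rw [Set.insert_sdiff_singleton, Set.insert_eq_of_mem he]
    rw [symmDiff_singleton_eq_of_mem he]
    conv_rhs => rw [hω]
    exact (h (ω \ {e}) (fun h' => h'.2 rfl)).symm
  · rw [symmDiff_singleton_eq_of_not_mem he]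
    exact h ω he

/-- "`t` is joined to `u` or to `v`" is insensitive to the pair `uv`. [folklore] -/
theorem wT_insens (u v t : V) (ω : BondConfig V) :
    ω ∆ {s(u, v)} ∈ ((openConn u t : Set (BondConfig V)) ∪ openConn v t) ↔ ω ∈ ((openConn u t : Set (BondConfig V)) ∪ openConn v t) := by
  refine insens_of_insert (fun ξ _ => ?_) ω
  have huu : (openGraph ξ).Reachable u u := SimpleGraph.Reachable.refl _
  have hvv : (openGraph ξ).Reachable v v := SimpleGraph.Reachable.refl _
  simp only [Set.mem_union, mem_openConn_iff', CoSunflowerGlue.openGraph_insert, CoSunflowerGlue.reachable_sup_edge_iff']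
  constructor
  · rintro (h | h)
    · rcases h with h | ⟨-, h⟩ | ⟨-, h⟩
      · exact Or.inl h
      · exact Or.inr h
      · exact Or.inl h
    · rcases h with h | ⟨-, h⟩ | ⟨-, h⟩
      · exact Or.inr h
      · exact Or.inr h
      · exact Or.inl h
  · rintro (h | h)
    · exact Or.inl (Or.inl h)
    · exact Or.inr (Or.inl h)

/-- "`z ↔ t` after merging `u` and `v`" — `z ↔ t`, or (`z ↔ u` and `v ↔ t`), or (`z ↔ v` and `u ↔ t`) — is insensitive to the pair `uv`. [folklore] -/
theorem cZT_insens (u v z t : V) (ω : BondConfig V) :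
    ω ∆ {s(u, v)} ∈ ((openConn z t : Set (BondConfig V)) ∪ (openConn z u ∩ openConn v t ∪ openConn z v ∩ openConn u t)) ↔
      ω ∈ ((openConn z t : Set (BondConfig V)) ∪ (openConn z u ∩ openConn v t ∪ openConn z v ∩ openConn u t)) := by
  refine insens_of_insert (fun ξ _ => ?_) ω
  have huu : (openGraph ξ).Reachable u u := SimpleGraph.Reachable.refl _
  have hvv : (openGraph ξ).Reachable v v := SimpleGraph.Reachable.refl _
  have sy : ∀ {a b : V}, (openGraph ξ).Reachable a b → (openGraph ξ).Reachable b a := fun h => h.symm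
  have tr : ∀ {a b c : V}, (openGraph ξ).Reachable a b → (openGraph ξ).Reachable b c → (openGraph ξ).Reachable a c := fun h h' => h.trans h'
  simp only [Set.mem_union, Set.mem_inter_iff, mem_openConn_iff', CoSunflowerGlue.openGraph_insert, CoSunflowerGlue.reachable_sup_edge_iff']
  constructor
  · rintro (hzt | ⟨hzu, hvt⟩ | ⟨hzv, hut⟩)
    · rcases hzt with h | ⟨h1, h2⟩ | ⟨h1, h2⟩
      · exact Or.inl h
      · exact Or.inr (Or.inl ⟨h1, h2⟩)
      · exact Or.inr (Or.inr ⟨h1, h2⟩)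
    · rcases hzu with hzu | ⟨hzu, -⟩ | ⟨hzv, -⟩ <;> rcases hvt with hvt | ⟨-, hvt⟩ | ⟨-, hut⟩
      · exact Or.inr (Or.inl ⟨hzu, hvt⟩)
      · exact Or.inr (Or.inl ⟨hzu, hvt⟩)
      · exact Or.inl (tr hzu hut)
      · exact Or.inr (Or.inl ⟨hzu, hvt⟩)
      · exact Or.inr (Or.inl ⟨hzu, hvt⟩)
      · exact Or.inl (tr hzu hut)
      · exact Or.inl (tr hzv hvt)
      · exact Or.inl (tr hzv hvt)
      · exact Or.inr (Or.inr ⟨hzv, hut⟩)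
    · rcases hzv with hzv | ⟨hzu, -⟩ | ⟨hzv, -⟩ <;> rcases hut with hut | ⟨-, hvt⟩ | ⟨-, hut⟩
      · exact Or.inr (Or.inr ⟨hzv, hut⟩)
      · exact Or.inl (tr hzv hvt)
      · exact Or.inr (Or.inr ⟨hzv, hut⟩)
      · exact Or.inl (tr hzu hut)
      · exact Or.inr (Or.inl ⟨hzu, hvt⟩)
      · exact Or.inl (tr hzu hut)
      · exact Or.inr (Or.inr ⟨hzv, hut⟩)
      · exact Or.inl (tr hzv hvt)
      · exact Or.inr (Or.inr ⟨hzv, hut⟩)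
  · rintro (hzt | ⟨hzu, hvt⟩ | ⟨hzv, hut⟩)
    · exact Or.inl (Or.inl hzt)
    · exact Or.inr (Or.inl ⟨Or.inl hzu, Or.inl hvt⟩)
    · exact Or.inr (Or.inr ⟨Or.inl hzv, Or.inl hut⟩)

/-- Toggling a pair off the apex commutes with deleting the apex pairs. [folklore] -/
theorem symmDiff_diff_apex_comm (ω : BondConfig V) {u v x : V} {e : Sym2 V} (h1 : e ≠ s(u, x)) (h2 : e ≠ s(x, v)) :
    (ω ∆ {e}) \ {s(u, x), s(x, v)} = (ω \ {s(u, x), s(x, v)}) ∆ {e} := by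
  ext f
  simp only [Set.mem_sdiff, Set.mem_symmDiff, Set.mem_singleton_iff, Set.mem_insert_iff]
  constructor
  · rintro ⟨hf | ⟨rfl, hn⟩, hD⟩
    · exact Or.inl ⟨⟨hf.1, hD⟩, hf.2⟩
    · exact Or.inr ⟨rfl, fun h => hn h.1⟩
  · rintro (⟨⟨hf, hD⟩, hne⟩ | ⟨rfl, hn⟩)
    · exact ⟨Or.inl ⟨hf, hne⟩, hD⟩
    · refine ⟨Or.inr ⟨rfl, fun hf => hn ⟨hf, ?_⟩⟩, ?_⟩
      · rintro (h | h); exact h1 h; exact h2 h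
      · rintro (h | h); exact h1 h; exact h2 h

/-- The preimage (apex-deleted) form of a `uv`-insensitive event is `uv`-insensitive, for a pair `uv` off the apex. [folklore] -/
theorem pre_insens {F : Set (BondConfig V)} {u v x : V} {e : Sym2 V} (h1 : e ≠ s(u, x)) (h2 : e ≠ s(x, v))
    (hF : ∀ ξ : BondConfig V, ξ ∆ {e} ∈ F ↔ ξ ∈ F) (ω : BondConfig V) :
    ω ∆ {e} ∈ {ω : BondConfig V | ω \ {s(u, x), s(x, v)} ∈ F} ↔ ω ∈ {ω : BondConfig V | ω \ {s(u, x), s(x, v)} ∈ F} := by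
  simp only [Set.mem_setOf_eq]
  rw [symmDiff_diff_apex_comm ω h1 h2]
  exact hF _

end FK

end Summit.CriticalPhenomena.PercolationContinuityZ3.Theorems

end
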